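import Mathlib.Analysis.Calculus.FDeriv.Mul
import Mathlib.Analysis.Calculus.FDeriv.Prod
import Mathlib.Analysis.Calculus.FDeriv.RestrictScalars
import Literature.NumberTheory.Transcendental.PureNaivePeriodMap
import Literature.AlgebraicGeometry.Motives.PolyFormPullback
import HarnessLib

/-!
# Push-forward of cubical chains along polynomial maps and the naive chain rule

Definition request `defn-AffineMotivatedPresentation` of route `KontsevichZagierPeriods/MotivatedMoves`,
part (a), chain side: for a polynomial map `F = (F₁, …, F_{N'}) : 𝔸ᴺ_K → 𝔸ᴺ'_K` (a tuple of
polynomials over a ring `K` with `σ : K →+* ℂ`) this file defines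

* `NaivePeriods.polyMapC σ F : ℂᴺ → ℂᴺ'` — the map on complex points, `z ↦ (Fⱼ^σ(z))ⱼ`;
* `NaivePeriods.SingularCube.pushforward σ F φ = F^σ ∘ φ` and its additive extension
  `NaivePeriods.CubicalChain.pushforward σ F : CubicalChain N i →+ CubicalChain N' i`
  (composition of cubes with `F^σ`), commuting with faces and with the boundary
  (`boundary_pushforward`) and mapping chains in `V(I)(ℂ)` to chains in `V(I')(ℂ)` when
  `F♯(I') ⊆ I` (`mapsTo_polyMapC_complexZeroLocus`);

and proves the **naive chain rule** relating it to the pull-back of polynomial forms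
`AffineDeRham.PolyForm.comap F` of `Motives/PolyFormPullback.lean`:

* `NaivePeriods.evalC_comap` — `(F^*ω)^σ(z)(w₁, …, wᵢ) = ω^σ(F^σ z)(DF^σ(z) w₁, …, DF^σ(z) wᵢ)`
  (pure algebra: the chain rule for `bind₁` and the multilinear expansion);
* `NaivePeriods.hasFDerivAt_polyMapC` — `F^σ` is (complex) differentiable with derivative the
  Jacobian `(∂Fⱼ/∂x_l)^σ(z)`;
* `NaivePeriods.SingularCube.integrand_pushforward`, `integral_pushforward` —
  **`∫_{F^σ ∘ φ} ω = ∫_φ F^*ω`** for a cube `φ` differentiable on the open unit cube (e.g. an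
  admissible cube of positive dimension), the change of variables behind "pull the form back to
  the parameter domain" [Huber–Müller-Stach 2017, Def. 12.1.1 and proof of Thm. 12.2.1;
  Spivak 1965, Ch. 4, `∫_{c} f^*ω`], and its additive extension to chains
  (`CubicalChain.integral_pushforward`).

## Design notes

* The differentiability of polynomial maps is re-derived here for `eval₂` along `σ`
  (`hasFDerivAt_eval₂`, induction on the polynomial) rather than imported from
  `AnalytificationFunctorialityProofs` (`MvPolynomial.hasStrictFDerivAt_eval`), whose manifold
  imports are disproportionate for this file.
* Admissibility (`ℚ`-semialgebraicity) of pushed-forward cubes is NOT proved here: it needs the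
  coefficients `σ(K)` to be real-algebraic in real and imaginary parts (true for a number field)
  and the composition lemmas for semialgebraic maps; routes take it as a hypothesis where needed.
* Mathlib: `HasFDerivAt.comp`, `HasFDerivAt.restrictScalars`, `hasFDerivAt_pi`,
  `MeasureTheory.setIntegral_congr_fun`; no integration along singular chains exists in Mathlib.

## References

* A. Huber, S. Müller-Stach, *Periods and Nori Motives* (2017), Def. 12.1.1, Thm. 12.2.1 (proof).
  [HuberMullerStachPeriods2017]
* M. Spivak, *Calculus on Manifolds* (1965), Ch. 4 (chains, `∫_c ω = ∫ c^*ω`). [Spivak1965]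
-/

noncomputable section

open MeasureTheory Set MvPolynomial
open Literature.AlgebraicGeometry.Motives Literature.AlgebraicGeometry.Motives.AffineDeRham

namespace Literature.NumberTheory.Transcendental

namespace NaivePeriods

variable {K : Type*} [CommRing K] (σ : K →+* ℂ) {N N' i : ℕ}

/-! ### Complex points of a polynomial map -/

/-- The map on complex points, along `σ`, of the polynomial map `F = (F₁, …, F_{N'}) : 𝔸ᴺ → 𝔸ᴺ'`:
`F^σ(z) = (F₁^σ(z), …, F_{N'}^σ(z))`. [folklore] -/
def polyMapC (F : Fin N' → MvPolynomial (Fin N) K) (z : Fin N → ℂ) : Fin N' → ℂ :=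
  fun j => eval₂ σ z (F j)

/-- Unfolding `polyMapC`. [folklore] -/
@[simp] theorem polyMapC_apply (F : Fin N' → MvPolynomial (Fin N) K) (z : Fin N → ℂ) (j : Fin N') :
    polyMapC σ F z j = eval₂ σ z (F j) := rfl

/-- `(g(F))^σ(z) = g^σ(F^σ(z))`: evaluation commutes with substitution. [folklore] -/
theorem eval₂_bind₁_eq (F : Fin N' → MvPolynomial (Fin N) K) (g : MvPolynomial (Fin N') K)
    (z : Fin N → ℂ) : eval₂ σ z (bind₁ F g) = eval₂ σ (polyMapC σ F z) g := by
  change eval₂Hom σ z (bind₁ F g) = eval₂Hom σ (polyMapC σ F z) g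
  rw [eval₂Hom_bind₁]
  rfl

/-- If `F` maps `V(I)` into `V(I')` algebraically (`F♯(I') ⊆ I`, i.e. `I'.map (bind₁ F) ≤ I`), then
`F^σ` maps `V(I)(ℂ)` into `V(I')(ℂ)`. [folklore] -/
theorem mapsTo_polyMapC_complexZeroLocus (F : Fin N' → MvPolynomial (Fin N) K)
    {I : Ideal (MvPolynomial (Fin N) K)} {I' : Ideal (MvPolynomial (Fin N') K)}
    (hF : I'.map (bind₁ F : MvPolynomial (Fin N') K →ₐ[K] MvPolynomial (Fin N) K) ≤ I) :
    MapsTo (polyMapC σ F) (complexZeroLocus σ I) (complexZeroLocus σ I') := by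
  intro z hz g hg
  rw [← eval₂_bind₁_eq]
  exact hz _ (hF (Ideal.mem_map_of_mem _ hg))

/-! ### Push-forward of cubes and chains -/

namespace SingularCube

/-- The **push-forward of a singular cube** along `F`: `F_* φ = F^σ ∘ φ`. [Spivak 1965, Ch. 4]
[folklore] -/
def pushforward (F : Fin N' → MvPolynomial (Fin N) K) (φ : SingularCube N i) : SingularCube N' i :=
  polyMapC σ F ∘ φ

/-- Unfolding `pushforward`. [folklore] -/
@[simp] theorem pushforward_apply (F : Fin N' → MvPolynomial (Fin N) K) (φ : SingularCube N i)
    (t : Fin i → ℝ) : pushforward σ F φ t = polyMapC σ F (φ t) := rfl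

/-- Faces commute with push-forward. [folklore] -/
theorem face_pushforward (F : Fin N' → MvPolynomial (Fin N) K) (j : Fin (i + 1)) (ε : ℝ)
    (φ : SingularCube N (i + 1)) : face j ε (pushforward σ F φ) = pushforward σ F (face j ε φ) :=
  rfl

/-- A cube mapping the closed cube into `S` is pushed forward to a cube mapping it into `T`
whenever `F^σ(S) ⊆ T`. [folklore] -/
theorem mapsTo_pushforward (F : Fin N' → MvPolynomial (Fin N) K) {S : Set (Fin N → ℂ)}
    {T : Set (Fin N' → ℂ)} (hF : MapsTo (polyMapC σ F) S T) {φ : SingularCube N i}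
    (hφ : MapsTo φ (closedUnitCube i) S) : MapsTo (pushforward σ F φ) (closedUnitCube i) T :=
  hF.comp hφ

end SingularCube

/-- The **push-forward of cubical chains** along `F`, the additive extension of
`φ ↦ F^σ ∘ φ`. [Spivak 1965, Ch. 4] [folklore] -/
def CubicalChain.pushforward (F : Fin N' → MvPolynomial (Fin N) K) :
    CubicalChain N i →+ CubicalChain N' i :=
  FreeAbelianGroup.map (SingularCube.pushforward σ F)

/-- Push-forward of a single cube. [folklore] -/
@[simp] theorem CubicalChain.pushforward_of (F : Fin N' → MvPolynomial (Fin N) K)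
    (φ : SingularCube N i) :
    CubicalChain.pushforward σ F (CubicalChain.of φ) = CubicalChain.of (φ.pushforward σ F) :=
  rfl

/-- **The boundary commutes with push-forward**: `∂(F_* γ) = F_*(∂γ)`. [Spivak 1965, Ch. 4]
[folklore] -/
theorem CubicalChain.boundary_pushforward (F : Fin N' → MvPolynomial (Fin N) K)
    (γ : CubicalChain N (i + 1)) :
    CubicalChain.boundary (CubicalChain.pushforward σ F γ) =
      CubicalChain.pushforward σ F (CubicalChain.boundary γ) := by
  induction γ using FreeAbelianGroup.induction_on with
  | zero => simp
  | of φ =>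
    change CubicalChain.boundary (CubicalChain.pushforward σ F (CubicalChain.of φ)) =
      CubicalChain.pushforward σ F (CubicalChain.boundary (CubicalChain.of φ))
    rw [CubicalChain.pushforward_of, CubicalChain.boundary_of, CubicalChain.boundary_of, map_sum]
    refine Finset.sum_congr rfl fun j _ => ?_
    rw [map_zsmul, map_sub, CubicalChain.pushforward_of, CubicalChain.pushforward_of,
      SingularCube.face_pushforward, SingularCube.face_pushforward]
  | neg φ h => simp only [map_neg, h]
  | add x y hx hy => simp only [map_add, hx, hy]

/-- Push-forward maps admissible chains in `S` made of cubes whose push-forwards are admissible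
to admissible chains in `T` whenever `F^σ(S) ⊆ T`: the general statement with admissibility of the
pushed cubes as a hypothesis (it depends on `σ(K)` being real-algebraic, see the module
docstring). [folklore] -/
theorem CubicalChain.IsAdmissibleIn.pushforward (F : Fin N' → MvPolynomial (Fin N) K)
    {S : Set (Fin N → ℂ)} {T : Set (Fin N' → ℂ)} (hF : MapsTo (polyMapC σ F) S T)
    (hadm : ∀ φ : SingularCube N i, φ.IsAdmissible → MapsTo φ (closedUnitCube i) S →
      (φ.pushforward σ F).IsAdmissible)
    {γ : CubicalChain N i} (hγ : γ.IsAdmissibleIn S) :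
    (CubicalChain.pushforward σ F γ).IsAdmissibleIn T := by
  induction hγ using AddSubgroup.closure_induction with
  | mem x hx =>
    obtain ⟨φ, ⟨hφ, hS⟩, rfl⟩ := hx
    rw [CubicalChain.pushforward_of]
    exact CubicalChain.isAdmissibleIn_of (hadm φ hφ hS) (SingularCube.mapsTo_pushforward σ F hF hS)
  | zero => rw [map_zero]; exact CubicalChain.IsAdmissibleIn.zero T
  | add x y _ _ hx hy => rw [map_add]; exact hx.add hy
  | neg x _ hx => rw [map_neg]; exact hx.neg

/-! ### The chain rule -/

/-- **The pulled-back form on complex vectors**: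
`(F^*ω)^σ(z)(w₁, …, wᵢ) = ω^σ(F^σ(z))(J(z) w₁, …, J(z) wᵢ)` with the Jacobian
`(J(z) w)ⱼ = Σ_l (∂Fⱼ/∂x_l)^σ(z) · w_l` (chain rule `dirDeriv_bind₁` and multilinear expansion
`∏ₐ Σ_l = Σ_J ∏ₐ`). [folklore] -/
theorem evalC_comap (F : Fin N' → MvPolynomial (Fin N) K) (ω : PolyForm K N' i) (z : Fin N → ℂ)
    (w : Fin i → Fin N → ℂ) :
    evalC σ (PolyForm.comap F ω) z w =
      evalC σ ω (polyMapC σ F z) (fun a j => ∑ l, eval₂ σ z (pderiv l (F j)) * w a l) := by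
  simp only [evalC, PolyForm.comap_apply, eval₂_sum, eval₂_mul, eval₂_prod, eval₂_bind₁_eq,
    dirDeriv_single_eq_pderiv, Finset.mul_sum]
  rw [Finset.sum_comm]
  refine Finset.sum_congr rfl fun J' _ => ?_
  rw [Finset.prod_univ_sum, Fintype.piFinset_univ, Finset.sum_mul]
  refine Finset.sum_congr rfl fun J _ => ?_
  rw [Finset.prod_mul_distrib]
  ring

/-- **Polynomial maps are differentiable**: `z ↦ f^σ(z)` has (complex) Fréchet derivative
`w ↦ Σ_l (∂f/∂x_l)^σ(z) · w_l` at every `z ∈ ℂᴺ` (induction on `f`; Leibniz rule). A local copy,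
for `eval₂` along `σ`, of the folklore lemma `MvPolynomial.hasStrictFDerivAt_eval` of
`AnalytificationFunctorialityProofs.lean` (whose imports are avoided here). [folklore] -/
theorem hasFDerivAt_eval₂ (f : MvPolynomial (Fin N) K) (z : Fin N → ℂ) :
    HasFDerivAt (fun z : Fin N → ℂ => eval₂ σ z f)
      (∑ l, eval₂ σ z (pderiv l f) •
        ContinuousLinearMap.proj (R := ℂ) (φ := fun _ : Fin N => ℂ) l) z := by
  induction f using MvPolynomial.induction_on with
  | C a =>
    have h0 : ∑ l, eval₂ σ z (pderiv l (C a : MvPolynomial (Fin N) K)) •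
        ContinuousLinearMap.proj (R := ℂ) (φ := fun _ : Fin N => ℂ) l = 0 :=
      Finset.sum_eq_zero fun l _ => by
        rw [pderiv_C, eval₂_zero]
        exact zero_smul ℂ (ContinuousLinearMap.proj (R := ℂ) (φ := fun _ : Fin N => ℂ) l)
    rw [h0]
    simp only [eval₂_C]
    exact hasFDerivAt_const (σ a) z
  | add p q hp hq =>
    simp only [eval₂_add]
    refine (hp.add hq).congr_fderiv ?_
    rw [← Finset.sum_add_distrib]
    exact Finset.sum_congr rfl fun l _ => by rw [map_add, eval₂_add]; exact (add_smul _ _ _).symm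
  | mul_X p l hp =>
    simp only [eval₂_mul, eval₂_X]
    have hX : HasFDerivAt (fun z : Fin N → ℂ => z l)
        (ContinuousLinearMap.proj (R := ℂ) (φ := fun _ : Fin N => ℂ) l) z :=
      (ContinuousLinearMap.proj (R := ℂ) (φ := fun _ : Fin N => ℂ) l).hasFDerivAt
    refine (hp.mul hX).congr_fderiv ?_
    ext w
    simp only [pderiv_mul, pderiv_X, eval₂_add, eval₂_mul, eval₂_X, Pi.single_apply,
      _root_.add_apply, FunLike.coe_smul, Pi.smul_apply, FunLike.coe_sum, Finset.sum_apply,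
      ContinuousLinearMap.proj_apply, smul_eq_mul]
    simp only [apply_ite (eval₂ σ z), eval₂_one, eval₂_zero, mul_ite, mul_one, mul_zero, add_mul,
      Finset.sum_add_distrib, ite_mul, zero_mul, Finset.sum_ite_eq, Finset.mem_univ, if_true,
      Finset.mul_sum]
    rw [add_comm]
    exact congrArg₂ (· + ·) (Finset.sum_congr rfl fun x _ => by ring) rfl

/-- The complex-points map `F^σ : ℂᴺ → ℂᴺ'` is differentiable, with derivative the Jacobian
`w ↦ (Σ_l (∂Fⱼ/∂x_l)^σ(z) w_l)ⱼ`. [folklore] -/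
theorem hasFDerivAt_polyMapC (F : Fin N' → MvPolynomial (Fin N) K) (z : Fin N → ℂ) :
    HasFDerivAt (polyMapC σ F)
      (ContinuousLinearMap.pi fun j => ∑ l, eval₂ σ z (pderiv l (F j)) •
        ContinuousLinearMap.proj (R := ℂ) (φ := fun _ : Fin N => ℂ) l) z :=
  hasFDerivAt_pi.2 fun j => hasFDerivAt_eval₂ σ (F j) z

namespace SingularCube

/-- **Chain rule for the push-forward of a cube**: at a point where `φ` is differentiable,
`D(F^σ ∘ φ)(t) v = J(φ t) (Dφ(t) v)`, `J` the Jacobian of `F^σ`. [folklore] -/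
theorem fderiv_pushforward_apply (F : Fin N' → MvPolynomial (Fin N) K) {φ : SingularCube N i}
    {t : Fin i → ℝ} (hφ : DifferentiableAt ℝ φ t) (v : Fin i → ℝ) (j : Fin N') :
    fderiv ℝ (pushforward σ F φ) t v j = ∑ l, eval₂ σ (φ t) (pderiv l (F j)) * fderiv ℝ φ t v l := by
  have h := ((hasFDerivAt_polyMapC σ F (φ t)).restrictScalars ℝ).comp t hφ.hasFDerivAt
  rw [show pushforward σ F φ = polyMapC σ F ∘ φ from rfl, h.fderiv]
  simp [ContinuousLinearMap.pi_apply]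

/-- **The naive chain rule, pointwise**: at a point of differentiability of the cube `φ`, the
integrand of `ω` along `F^σ ∘ φ` is the integrand of `F^*ω` along `φ`. [folklore] -/
theorem integrand_pushforward (F : Fin N' → MvPolynomial (Fin N) K) (ω : PolyForm K N' i)
    {φ : SingularCube N i} {t : Fin i → ℝ} (hφ : DifferentiableAt ℝ φ t) :
    integrand σ ω (pushforward σ F φ) t = integrand σ (PolyForm.comap F ω) φ t := by
  rw [integrand, integrand, evalC_comap, pushforward_apply]
  congr 1
  funext a j
  rw [fderiv_pushforward_apply σ F hφ]

/-- The open unit cube is open. [folklore] -/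
theorem _root_.Literature.NumberTheory.Transcendental.NaivePeriods.isOpen_openUnitCube :
    IsOpen (openUnitCube i) :=
  isOpen_set_pi finite_univ fun _ _ => isOpen_Ioo

/-- **The naive chain rule** `∫_{F^σ ∘ φ} ω = ∫_φ F^*ω` for a cube `φ` differentiable on the open
unit cube (e.g. an admissible cube of positive dimension): the composite cube integrates `ω`
exactly as `φ` integrates the pulled-back form [Huber–Müller-Stach 2017, proof of Thm. 12.2.1;
Spivak 1965, Ch. 4]. [folklore] -/
theorem integral_pushforward (F : Fin N' → MvPolynomial (Fin N) K) (ω : PolyForm K N' i)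
    {φ : SingularCube N i} (hφ : DifferentiableOn ℝ φ (openUnitCube i)) :
    integral σ ω (pushforward σ F φ) = integral σ (PolyForm.comap F ω) φ :=
  setIntegral_congr_fun isOpen_openUnitCube.measurableSet fun _ ht =>
    integrand_pushforward σ F ω (hφ.differentiableAt (isOpen_openUnitCube.mem_nhds ht))

/-- Admissible cubes of positive dimension are differentiable on the open cube, so the naive chain
rule applies to them. [folklore] -/
theorem IsAdmissible.integral_pushforward (F : Fin N' → MvPolynomial (Fin N) K)
    (ω : PolyForm K N' (i + 1)) {φ : SingularCube N (i + 1)} (hφ : φ.IsAdmissible) :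
    integral σ ω (pushforward σ F φ) = integral σ (PolyForm.comap F ω) φ :=
  SingularCube.integral_pushforward σ F ω (hφ.2.2.1.differentiableOn (by simp))

end SingularCube

/-- **The naive chain rule along chains**: `∫_{F_* γ} ω = ∫_γ F^*ω` for a chain `γ` all of whose
cubes are admissible (positive dimension), e.g. an admissible chain in any `S`. [folklore] -/
theorem CubicalChain.integral_pushforward (F : Fin N' → MvPolynomial (Fin N) K)
    (ω : PolyForm K N' (i + 1)) {S : Set (Fin N → ℂ)} {γ : CubicalChain N (i + 1)}
    (hγ : γ.IsAdmissibleIn S) :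
    CubicalChain.integral σ ω (CubicalChain.pushforward σ F γ) =
      CubicalChain.integral σ (PolyForm.comap F ω) γ := by
  induction hγ using AddSubgroup.closure_induction with
  | mem x hx =>
    obtain ⟨φ, ⟨hφ, -⟩, rfl⟩ := hx
    rw [CubicalChain.pushforward_of, CubicalChain.integral_of, CubicalChain.integral_of]
    exact hφ.integral_pushforward σ F ω
  | zero => simp
  | add x y _ _ hx hy => rw [map_add, map_add, map_add, hx, hy]
  | neg x _ hx => rw [map_neg, map_neg, map_neg, hx]

end NaivePeriods

end Literature.NumberTheory.Transcendental

end
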